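import Literature.Analysis.FluidPDE.TaoClassGlue
import Literature.Analysis.FluidPDE.LpMildKatoClassical
import Literature.Analysis.FluidPDE.ClassicalSolutionRescale
import HarnessLib

/-!
# Route `GaldiLiouvilleGate`, crux `RecordZoomAncient` (stmt-NavierStokesRegularity-0894),
  line `registered` (birth skeleton, reshape r2) — stub `stub_zoomBound`
  (the universal velocity bound after one critical time unit)

**Statement.** There is a universal constant `C` such that: if `(u, p)` is a classical
solution of the unforced Navier–Stokes system (viscosity `ν > 0`) on `ℝ³ × [0, T)` which is
Leray–Hopf on `[0, T]` from its rapidly decaying datum `u 0` and a solution in Tao's smooth `H¹`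
class on every closed sub-slab `[0, T']`, `0 < T' < T`, and if its enstrophy is dominated by a
level `L > 0` on `[0, tc]` (`0 < tc < T`), `∫ |∇u(t)|² ≤ L`, then `‖u(t, x)‖ ≤ C L/ν` for all
`x` and all `t ∈ [ν³/L², tc]`: after ONE critical time unit `ν³/L²` the velocity is bounded by
a universal multiple of the enstrophy velocity scale `L/ν`.

**Proof.** `Ḣ¹` is subcritical. Fix `t ∈ [ν³/L², tc)` and put `α = ν/L`, `γ = ν²/L`,
`β = α γ = ν³/L²`, `s₁ = t - δ β` (`δ < 1` universal, below). The zoom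
`w(s, y) = α u(s₁ + β s, γ y)` (with pressure `α² P(s₁ + β s, γ y)`, `P` the Tao-class
pressure) is a classical solution with viscosity `α ν/γ = 1`
(`IsClassicalNSSolutionOn.stRescale`), bounded together with its pressure on the closed slab
`[0, T_k]`, `T_k = (tc - s₁)/β > δ` (Tao class: `exists_bound_velocity`,
`exists_bound_pressure`), hence mild from `w 0` (Fabes–Jones–Rivière 1972,
`IsClassicalNSSolutionOn.isMildNSSolutionOn_holds`); its slices are `C^∞ ∩ L²` with
`∫ |∇w(s)|² = (α γ)² γ⁻³ ∫ |∇u|² = L⁻¹ ∫ |∇u|² ≤ 1`, so `‖w(s)‖_{L⁶} ≤ C_S` (Sobolev,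
`eLpNorm_six_le_eLpNorm_fderiv_two`). Kato's `L⁶` comparison `LpMildKato.exists_kato_time`
(`p = 6`, `M = C_S`; Kato 1984, Thm. 1 and §2) yields universal `κ > 0`, `C_b` with
`w(s) = u_K(s)` a.e. and `|u_K(s)| ≤ C_b s^{-1/2}` for `s ∈ (0, min(T_k, κ))`; with
`δ = min(1, κ)/2` and continuity of the slices, `|w(δ, y)| ≤ C_b δ^{-1/2} =: C` for all `y`,
i.e. `‖u(t, x)‖ ≤ C L/ν` (`unit_kato_bound`, `core_bound`). The endpoint `t = tc` follows by
continuity in time (`stub_zoomBound`).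

Sources: T. Kato, *Strong `L^p`-solutions of the Navier–Stokes equation in `ℝ^m`*, Math. Z. 187
(1984), Thm. 1, §2; E. B. Fabes, B. F. Jones, N. M. Rivière, Arch. Rational Mech. Anal. 45
(1972), Thm. 2.1; J. Leray, Acta Math. 63 (1934), §20 (similarity); L. C. Evans, *PDE*, §5.6.1
(Gagliardo–Nirenberg–Sobolev).
-/

noncomputable section

open Set MeasureTheory Filter Topology Function
open scoped ENNReal NNReal RealInnerProductSpace
open Literature.Analysis.FluidPDE

namespace Summit.NavierStokesRegularity.NavierStokesRegularity.Theorems.RecordZoomAncient.Birth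

-- the problem-side namespace `Summit.NavierStokesRegularity.NavierStokesRegularity.…` (summit =
-- problem for this single-problem summit) duplicates `NavierStokesRegularity` by design
set_option linter.dupNamespace false

/-! ### Tools -/

/-- An a.e. bound of a continuous field on `ℝ³` holds everywhere (the exceptional set is open
and null, hence empty). -/
theorem forall_norm_le_of_ae_of_continuous
    {f : EuclideanSpace ℝ (Fin 3) → EuclideanSpace ℝ (Fin 3)} (hf : Continuous f) {M : ℝ}
    (h : ∀ᵐ x ∂(volume : Measure (EuclideanSpace ℝ (Fin 3))), ‖f x‖ ≤ M) : ∀ x, ‖f x‖ ≤ M := by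
  have hopen : IsOpen {x : EuclideanSpace ℝ (Fin 3) | M < ‖f x‖} :=
    isOpen_lt continuous_const hf.norm
  have hnull : volume {x : EuclideanSpace ℝ (Fin 3) | M < ‖f x‖} = 0 := by
    have h' := ae_iff.1 h
    simpa only [not_le] using h'
  have hempty := (hopen.measure_eq_zero_iff volume).1 hnull
  intro x
  by_contra hx
  have hmem : x ∈ {x : EuclideanSpace ℝ (Fin 3) | M < ‖f x‖} := not_le.1 hx
  rw [hempty] at hmem
  exact hmem

/-- The duality identity from the datum at a time `t ≥ 0` only involves the slices on `[0, t]`: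
it transfers from `w` to any field `W` with `W τ = w τ` for `τ ∈ [0, t]`. -/
theorem isMildNSSolutionFrom_of_eqOn
    {w W : ℝ → EuclideanSpace ℝ (Fin 3) → EuclideanSpace ℝ (Fin 3)} {t : ℝ} (ht : 0 ≤ t)
    (heq : ∀ τ ∈ Icc 0 t, W τ = w τ) (h : IsMildNSSolutionFrom 1 0 (w 0) w t) :
    IsMildNSSolutionFrom 1 0 (W 0) W t := by
  intro φ hφ hdiv
  have key := h φ hφ hdiv
  have hint : ∫ τ in (0 : ℝ)..t, ∫ x, ⟪W τ x, convect (W τ) (heatTest 1 φ (t - τ)) x⟫ =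
      ∫ τ in (0 : ℝ)..t, ∫ x, ⟪w τ x, convect (w τ) (heatTest 1 φ (t - τ)) x⟫ :=
    intervalIntegral.integral_congr fun τ hτ => by
      rw [uIcc_of_le ht] at hτ
      simp only [heq τ hτ]
  rw [heq t ⟨ht, le_rfl⟩, heq 0 ⟨le_rfl, ht⟩, hint]
  exact key

/-- **Sobolev on a slice with enstrophy at most one**: a `C¹` field `v` on `ℝ³` with
`‖v‖_{L²} < ∞` and `∫ |∇v|² ≤ 1` has `‖v‖_{L⁶} ≤ C_S`, Mathlib's Gagliardo–Nirenberg–Sobolev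
constant (`eLpNorm_six_le_eLpNorm_fderiv_two` and the operator-vs-Frobenius bound
`eLpNorm_two_le_lintegral_frobenius_rpow`). -/
theorem eLpNorm_six_le_const_of_enstrophy_le_one
    {v : EuclideanSpace ℝ (Fin 3) → EuclideanSpace ℝ (Fin 3)} (hv : ContDiff ℝ 1 v)
    (h2 : eLpNorm v 2 volume < ∞)
    (hE : ∫⁻ y, ENNReal.ofReal (frobeniusNormSq (fderiv ℝ v y)) ≤ 1) :
    eLpNorm v 6 volume ≤
      SNormLESNormFDerivOfEqConst (EuclideanSpace ℝ (Fin 3))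
        (volume : Measure (EuclideanSpace ℝ (Fin 3))) 2 := by
  have h3 : Module.finrank ℝ (EuclideanSpace ℝ (Fin 3)) = 3 := finrank_euclideanSpace_fin
  calc eLpNorm v 6 volume
      ≤ SNormLESNormFDerivOfEqConst (EuclideanSpace ℝ (Fin 3))
          (volume : Measure (EuclideanSpace ℝ (Fin 3))) 2 * eLpNorm (fderiv ℝ v) 2 volume :=
        eLpNorm_six_le_eLpNorm_fderiv_two volume h3 hv h2
    _ ≤ SNormLESNormFDerivOfEqConst (EuclideanSpace ℝ (Fin 3))
          (volume : Measure (EuclideanSpace ℝ (Fin 3))) 2 * 1 := by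
        gcongr
        calc eLpNorm (fderiv ℝ v) 2 volume
            ≤ (∫⁻ y, ENNReal.ofReal (frobeniusNormSq (fderiv ℝ v y))) ^ (1 / 2 : ℝ) :=
              eLpNorm_two_le_lintegral_frobenius_rpow volume _
          _ ≤ 1 ^ (1 / 2 : ℝ) := ENNReal.rpow_le_rpow hE (by norm_num)
          _ = 1 := ENNReal.one_rpow _
    _ = _ := mul_one _

/-! ### The Kato step at unit scale -/

/-- **The Kato step at unit viscosity and unit enstrophy.** There are universal `κ > 0` and
`C_b ≥ 0` such that: if `(w, q)` is a classical solution of the unforced Navier–Stokes system with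
viscosity `1` on a time set `S ⊇ [0, T_k]`, `0 < T_k`, with `w`, `q` bounded on `[0, T_k] × ℝ³`,
`L²` slices and enstrophy `∫ |∇w(s)|² ≤ 1` for `s ∈ [0, T_k]`, then `‖w(s, y)‖ ≤ C_b s^{-1/2}` for
all `s ∈ (0, min T_k κ)` and all `y`. Proof: the slices have `‖w(s)‖_{L⁶} ≤ C_S` (Sobolev); the
bounded classical solution is mild from `w 0` (`IsClassicalNSSolutionOn.isMildNSSolutionOn_holds`,
Fabes–Jones–Rivière 1972); Kato's `L⁶` comparison `LpMildKato.exists_kato_time` (constants from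
`p = 6`, `M = C_S` only), applied to the time-clamped field `W τ = w(proj_{[0, T_k]} τ)` (jointly
continuous, hence measurable), gives `w(s) = u_K(s)` a.e. with `|u_K(s)| ≤ C_b s^{-1/2}`, and the
slices of `w` are continuous. -/
theorem unit_kato_bound : ∃ κ : ℝ, 0 < κ ∧ ∃ Cb : ℝ, 0 ≤ Cb ∧
    ∀ ⦃S : Set ℝ⦄ ⦃w : ℝ → EuclideanSpace ℝ (Fin 3) → EuclideanSpace ℝ (Fin 3)⦄
      ⦃q : ℝ → EuclideanSpace ℝ (Fin 3) → ℝ⦄ ⦃Tk : ℝ⦄,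
      IsClassicalNSSolutionOn S 1 0 w q → 0 < Tk → Icc 0 Tk ⊆ S →
      IsBoundedOn (Icc 0 Tk) w → IsBoundedOn (Icc 0 Tk) q →
      (∀ s ∈ Icc 0 Tk, eLpNorm (w s) 2 volume < ∞) →
      (∀ s ∈ Icc 0 Tk, ∫⁻ y, ENNReal.ofReal (frobeniusNormSq (fderiv ℝ (w s) y)) ≤ 1) →
      ∀ s ∈ Ioo 0 (min Tk κ), ∀ y, ‖w s y‖ ≤ Cb * s ^ (-(1 / 2 : ℝ)) := by
  set K : ℝ≥0 := SNormLESNormFDerivOfEqConst (EuclideanSpace ℝ (Fin 3))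
    (volume : Measure (EuclideanSpace ℝ (Fin 3))) 2 with hK
  obtain ⟨κ, hκ, Cb, hCb, H⟩ :=
    LpMildKato.exists_kato_time (p := 6) (by norm_num) (ENNReal.ofNat_lt_top) K
  refine ⟨κ, hκ, Cb, hCb, ?_⟩
  intro S w q Tk hcl hTk hS hbw hbq hL2 hE s hs y
  -- slices: smooth, Sobolev-bounded in `L⁶`
  have hC1 : ∀ τ ∈ Icc 0 Tk, ContDiff ℝ 1 (w τ) := fun τ hτ =>
    contDiff_infty.1 (hcl.contDiff_velocity (hS hτ)) 1
  have h6 : ∀ τ ∈ Icc 0 Tk, eLpNorm (w τ) 6 volume ≤ K := fun τ hτ =>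
    eLpNorm_six_le_const_of_enstrophy_le_one (hC1 τ hτ) (hL2 τ hτ) (hE τ hτ)
  -- the bounded classical solution is mild from `w 0`
  have hmild : IsMildNSSolutionOn (Icc 0 Tk) 1 0 (w 0) w :=
    IsClassicalNSSolutionOn.isMildNSSolutionOn_holds hcl one_pos hS hbw hbq
      ⟨0, fun t _ x => by simp⟩
  -- the time-clamped field, jointly continuous
  set W : ℝ → EuclideanSpace ℝ (Fin 3) → EuclideanSpace ℝ (Fin 3) :=
    fun τ => w (projIcc 0 Tk hTk.le τ) with hW
  have hWmem : ∀ τ, (projIcc 0 Tk hTk.le τ : ℝ) ∈ Icc 0 Tk := fun τ => (projIcc 0 Tk hTk.le τ).2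
  have hWeq : ∀ τ ∈ Icc 0 Tk, W τ = w τ := fun τ hτ => by
    simp only [hW, projIcc_of_mem hTk.le hτ]
  have hWcont : Continuous (uncurry W) := by
    have h1 : ContinuousOn (uncurry w) (Icc 0 Tk ×ˢ univ) :=
      hcl.smooth_velocity.continuousOn.mono (prod_mono hS Subset.rfl)
    have h2 : Continuous fun z : ℝ × EuclideanSpace ℝ (Fin 3) =>
        ((projIcc 0 Tk hTk.le z.1 : ℝ), z.2) :=
      (continuous_subtype_val.comp (continuous_projIcc.comp continuous_fst)).prodMk continuous_snd
    exact h1.comp_continuous h2 fun z => ⟨hWmem z.1, mem_univ _⟩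
  have hWslice : ∀ τ, Continuous (W τ) := fun τ => (hC1 _ (hWmem τ)).continuous
  -- Kato's hypotheses for `W` on `(0, T_k)`
  have hK6 : ∀ τ, eLpNorm (W τ) 6 volume ≤ K := fun τ => h6 _ (hWmem τ)
  have hKdiv : ∀ τ, IsWeaklyDivFree (W τ) := fun τ => hmild.1 _ (hWmem τ)
  have hKm : ∀ τ, MemLp (W τ) 6 volume := fun τ =>
    ⟨(hWslice τ).aestronglyMeasurable, (hK6 τ).trans_lt ENNReal.coe_lt_top⟩
  have hKmild : ∀ t ∈ Ioo 0 Tk, IsMildNSSolutionFrom 1 0 (W 0) W t := fun t ht =>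
    isMildNSSolutionFrom_of_eqOn ht.1.le (fun τ hτ => hWeq τ ⟨hτ.1, hτ.2.trans ht.2.le⟩)
      (hmild.2 t ⟨ht.1.le, ht.2.le⟩)
  obtain ⟨uK, -, hKb, hae⟩ := H hWcont.measurable (hWslice 0).stronglyMeasurable (hKm 0) (hK6 0)
    (hKdiv 0) hTk (fun τ _ => hK6 τ) (fun τ _ => hKdiv τ) hKmild
  -- conclusion at the time `s`: a.e. from Kato, everywhere by continuity of the slice
  have hsk : s ∈ Icc 0 Tk := ⟨hs.1.le, (hs.2.trans_le (min_le_left _ _)).le⟩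
  have hae_s : ∀ᵐ x ∂(volume : Measure (EuclideanSpace ℝ (Fin 3))),
      ‖w s x‖ ≤ Cb * s ^ (-(1 / 2 : ℝ)) := by
    filter_upwards [hae s hs] with x hx
    rw [← hWeq s hsk, hx]
    exact hKb s hs x
  exact forall_norm_le_of_ae_of_continuous (hC1 s hsk).continuous hae_s y

/-! ### The enstrophy-normalised zoom -/

/-- Space change of variables on `ℝ³`: `∫⁻ F(γ y) dy = (γ³)⁻¹ ∫⁻ F` for `γ > 0`
(`lintegral_comp_space_affine`). -/
theorem lintegral_comp_smul_three {γ : ℝ} (hγ : 0 < γ)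
    (F : EuclideanSpace ℝ (Fin 3) → ℝ≥0∞) :
    ∫⁻ y, F (γ • y) = ENNReal.ofReal (γ ^ 3)⁻¹ * ∫⁻ x, F x := by
  have h := lintegral_comp_space_affine hγ (0 : EuclideanSpace ℝ (Fin 3)) F
  simp only [zero_add, finrank_euclideanSpace_fin] at h
  exact h

/-- The slices of the zoom `α • stPull β γ s₁ 0 u`: `y ↦ α • u (s₁ + β r) (γ y)`. -/
theorem zoom_slice (α β γ s₁ : ℝ)
    (u : ℝ → EuclideanSpace ℝ (Fin 3) → EuclideanSpace ℝ (Fin 3)) (r : ℝ) :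
    (α • stPull β γ s₁ 0 u) r = fun y => α • u (s₁ + β * r) (γ • y) := by
  funext y
  simp [stPull_apply]

/-- The gradient of a zoom slice: `∇(α u(τ, γ ·))(y) = (α γ) ∇u(τ)(γ y)` (`fderiv_stPull`). -/
theorem fderiv_zoom_slice (α β γ s₁ : ℝ)
    (u : ℝ → EuclideanSpace ℝ (Fin 3) → EuclideanSpace ℝ (Fin 3)) (r : ℝ)
    (y : EuclideanSpace ℝ (Fin 3)) :
    fderiv ℝ ((α • stPull β γ s₁ 0 u) r) y = (α * γ) • fderiv ℝ (u (s₁ + β * r)) (γ • y) := by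
  rw [show (α • stPull β γ s₁ 0 u) r = α • stPull β γ s₁ 0 u r from rfl,
    fderiv_const_smul_field, Pi.smul_apply, fderiv_stPull, smul_smul, zero_add]

/-- **The enstrophy of a zoom slice**: `∫ |∇(α u(τ, γ ·))|² = (α γ)² γ⁻³ ∫ |∇u(τ)|²`
(`frobeniusNormSq_smul` and the change of variables `y ↦ γ y`). -/
theorem lintegral_frobenius_zoom_slice (α β : ℝ) {γ : ℝ} (hγ : 0 < γ) (s₁ : ℝ)
    (u : ℝ → EuclideanSpace ℝ (Fin 3) → EuclideanSpace ℝ (Fin 3)) (r : ℝ) :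
    ∫⁻ y, ENNReal.ofReal (frobeniusNormSq (fderiv ℝ ((α • stPull β γ s₁ 0 u) r) y)) =
      ENNReal.ofReal ((α * γ) ^ 2 * (γ ^ 3)⁻¹) *
        ∫⁻ x, ENNReal.ofReal (frobeniusNormSq (fderiv ℝ (u (s₁ + β * r)) x)) := by
  simp_rw [fderiv_zoom_slice, frobeniusNormSq_smul, ENNReal.ofReal_mul (sq_nonneg _)]
  rw [lintegral_const_mul' _ _ ENNReal.ofReal_ne_top,
    lintegral_comp_smul_three hγ
      (fun x => ENNReal.ofReal (frobeniusNormSq (fderiv ℝ (u (s₁ + β * r)) x))),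
    ← mul_assoc, ← ENNReal.ofReal_mul (sq_nonneg _)]

/-- **The `L²` mass of a zoom slice** is finite when the original slice has finite energy
(`‖α v‖ₑ² = ‖α‖ₑ² ‖v‖ₑ²` and the change of variables `y ↦ γ y`). -/
theorem lintegral_enorm_sq_zoom_slice_lt_top (α β : ℝ) {γ : ℝ} (hγ : 0 < γ) (s₁ : ℝ)
    {u : ℝ → EuclideanSpace ℝ (Fin 3) → EuclideanSpace ℝ (Fin 3)} {r : ℝ}
    (h : ∫⁻ x, ‖u (s₁ + β * r) x‖ₑ ^ 2 < ⊤) :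
    ∫⁻ y, ‖(α • stPull β γ s₁ 0 u) r y‖ₑ ^ 2 < ⊤ := by
  rw [zoom_slice]
  simp only [enorm_smul, mul_pow]
  rw [lintegral_const_mul' _ _ (by simp),
    lintegral_comp_smul_three hγ (fun x => ‖u (s₁ + β * r) x‖ₑ ^ 2)]
  exact ENNReal.mul_lt_top (by simp) (ENNReal.mul_lt_top ENNReal.ofReal_lt_top h)

/-- **The core bound, strictly before the base time.** There are universal `0 < δ < 1` and `C`
such that: if `u` is Leray–Hopf on `[0, T]` (viscosity `ν > 0`) from `u 0`, Tao-class on every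
`[0, T']`, `0 < T' < T`, and has enstrophy `≤ L` on `[0, tc]` (`tc < T`, `0 < L`), then
`‖u(t', x)‖ ≤ C L/ν` for all `x` and all `t' ∈ [δ ν³/L², tc)`. Proof: with `κ, C_b` from
`unit_kato_bound`, `δ = min(1, κ)/2`, `C = C_b δ^{-1/2}`; the zoom
`w = α • stPull β γ s₁ 0 u` (`α = ν/L`, `γ = ν²/L`, `β = ν³/L²`, `s₁ = t' - δ β ≥ 0`) of the
Tao-class solution on `[0, (tc + T)/2]` is classical with viscosity `α ν/γ = 1`
(`IsClassicalNSSolutionOn.stRescale`), bounded with bounded pressure on `[0, T_k]`,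
`T_k = (tc - s₁)/β > δ`, with `L²` slices (Leray–Hopf energy bound) of enstrophy
`(α γ)² γ⁻³ ∫ |∇u|² ≤ (α γ)² γ⁻³ L = 1`; `unit_kato_bound` at the rescaled time
`δ ∈ (0, min T_k κ)` and the point `γ⁻¹ x` reads `α ‖u(t', x)‖ ≤ C_b δ^{-1/2}`. -/
theorem core_bound : ∃ δ C : ℝ, 0 < δ ∧ δ < 1 ∧ ∀ (ν T : ℝ), 0 < ν →
    ∀ (u : ℝ → EuclideanSpace ℝ (Fin 3) → EuclideanSpace ℝ (Fin 3)),
      IsLerayHopfOn T ν 0 (u 0) u →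
      (∀ T' ∈ Set.Ioo 0 T, ∃ P : ℝ → EuclideanSpace ℝ (Fin 3) → ℝ,
        IsTaoSolutionOn T' ν (u 0) u P) →
      ∀ (tc L : ℝ), tc < T → 0 < L →
        (∀ t ∈ Set.Icc 0 tc,
          ∫⁻ x, ENNReal.ofReal (frobeniusNormSq (fderiv ℝ (u t) x)) ≤ ENNReal.ofReal L) →
        ∀ t', δ * (ν ^ 3 / L ^ 2) ≤ t' → t' < tc → ∀ x, ‖u t' x‖ ≤ C * L / ν := by
  obtain ⟨κ, hκ, Cb, -, H⟩ := unit_kato_bound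
  set δ : ℝ := min 1 κ / 2 with hδ
  have hδ0 : 0 < δ := by positivity
  have hδ1 : δ < 1 := by
    have : min 1 κ ≤ 1 := min_le_left _ _
    rw [hδ]; linarith
  have hδκ : δ < κ := by
    have : min 1 κ ≤ κ := min_le_right _ _
    rw [hδ]; linarith
  refine ⟨δ, Cb * δ ^ (-(1 / 2 : ℝ)), hδ0, hδ1, ?_⟩
  intro ν T hν u hLH hrep tc L htcT hL hE t' ht'₁ ht'₂ x
  -- ### scales
  set α : ℝ := ν / L with hα_def
  set γ : ℝ := ν ^ 2 / L with hγ_def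
  set β : ℝ := ν ^ 3 / L ^ 2 with hβ_def
  have hα : 0 < α := by positivity
  have hγ : 0 < γ := by positivity
  have hβ : 0 < β := by positivity
  have hβαγ : β = α * γ := by rw [hα_def, hγ_def, hβ_def]; field_simp
  have hvisc : α * ν / γ = 1 := by rw [hα_def, hγ_def]; field_simp
  have hunit : (α * γ) ^ 2 * (γ ^ 3)⁻¹ * L = 1 := by rw [hα_def, hγ_def]; field_simp
  -- ### times: restart at `s₁ = t' - δ β ≥ 0`, rescaled horizon `T_k = (tc - s₁)/β > δ`
  set s₁ : ℝ := t' - δ * β with hs₁_def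
  have hs₁ : 0 ≤ s₁ := by rw [hs₁_def]; linarith
  have htc : 0 < tc := by
    have : 0 < δ * β := mul_pos hδ0 hβ
    linarith
  have hT₁ : (tc + T) / 2 ∈ Ioo 0 T := ⟨by linarith, by linarith⟩
  obtain ⟨P, hP⟩ := hrep _ hT₁
  set Tk : ℝ := (tc - s₁) / β with hTk_def
  have hδTk : δ < Tk := by
    rw [hTk_def, lt_div_iff₀ hβ, hs₁_def]; linarith
  have hTk0 : 0 < Tk := hδ0.trans hδTk
  have hβTk : β * Tk = tc - s₁ := by rw [hTk_def]; field_simp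
  have horig : ∀ r ∈ Icc 0 Tk, s₁ + β * r ∈ Icc 0 tc := fun r hr =>
    ⟨by nlinarith [hr.1, hβ.le], by nlinarith [hr.2, hβ.le]⟩
  have horigT₁ : ∀ r ∈ Icc 0 Tk, s₁ + β * r ∈ Icc 0 ((tc + T) / 2) := fun r hr =>
    ⟨(horig r hr).1, by linarith [(horig r hr).2]⟩
  have hS : Icc 0 Tk ⊆ (fun r => s₁ + β * r) ⁻¹' Icc 0 ((tc + T) / 2) := fun r hr => horigT₁ r hr
  -- ### the zoom is a classical solution with viscosity one
  have hcl : IsClassicalNSSolutionOn ((fun r => s₁ + β * r) ⁻¹' Icc 0 ((tc + T) / 2)) 1 0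
      (α • stPull β γ s₁ 0 u) (α ^ 2 • stPull β γ s₁ 0 P) := by
    have h := hP.classical.stRescale hα hγ hβαγ s₁ 0
    rwa [smul_stPull_zero, hvisc] at h
  -- ### boundedness of the zoom and of its pressure on `[0, T_k]`
  obtain ⟨B, -, hB⟩ := hP.exists_bound_velocity
  obtain ⟨Pb, -, hPb⟩ := hP.exists_bound_pressure
  have hbw : IsBoundedOn (Icc 0 Tk) (α • stPull β γ s₁ 0 u) := by
    refine ⟨α * B, fun r hr y => ?_⟩
    rw [zoom_slice]
    simp only [norm_smul, Real.norm_eq_abs, abs_of_pos hα]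
    exact mul_le_mul_of_nonneg_left (hB _ (horigT₁ r hr) _) hα.le
  have hbq : IsBoundedOn (Icc 0 Tk) (α ^ 2 • stPull β γ s₁ 0 P) := by
    refine ⟨α ^ 2 * Pb, fun r hr y => ?_⟩
    simp only [Pi.smul_apply, stPull_apply, zero_add, norm_smul, Real.norm_eq_abs, abs_pow,
      abs_of_pos hα]
    exact mul_le_mul_of_nonneg_left (hPb _ (horigT₁ r hr) _) (by positivity)
  -- ### `L²` slices and unit enstrophy on `[0, T_k]`
  have hL2 : ∀ r ∈ Icc 0 Tk, eLpNorm ((α • stPull β γ s₁ 0 u) r) 2 volume < ∞ := by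
    intro r hr
    refine eLpNorm_two_lt_top_of_lintegral_enorm_sq_lt_top
      (lintegral_enorm_sq_zoom_slice_lt_top α β hγ s₁ ?_)
    have hτ : s₁ + β * r ∈ Icc 0 T := ⟨(horig r hr).1, (horig r hr).2.trans htcT.le⟩
    exact (hLH.lintegral_enorm_sq_le hν.le hτ).trans_lt ENNReal.ofReal_lt_top
  have hE1 : ∀ r ∈ Icc 0 Tk,
      ∫⁻ y, ENNReal.ofReal (frobeniusNormSq (fderiv ℝ ((α • stPull β γ s₁ 0 u) r) y)) ≤ 1 := by
    intro r hr
    rw [lintegral_frobenius_zoom_slice α β hγ s₁ u r]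
    calc ENNReal.ofReal ((α * γ) ^ 2 * (γ ^ 3)⁻¹) *
          ∫⁻ x, ENNReal.ofReal (frobeniusNormSq (fderiv ℝ (u (s₁ + β * r)) x))
        ≤ ENNReal.ofReal ((α * γ) ^ 2 * (γ ^ 3)⁻¹) * ENNReal.ofReal L :=
          mul_le_mul' le_rfl (hE _ (horig r hr))
      _ = 1 := by
          rw [← ENNReal.ofReal_mul (by positivity), hunit, ENNReal.ofReal_one]
  -- ### Kato's bound at the rescaled time `δ`, i.e. at the original time `t'`
  have hδmem : δ ∈ Ioo 0 (min Tk κ) := ⟨hδ0, lt_min hδTk hδκ⟩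
  have key := H hcl hTk0 hS hbw hbq hL2 hE1 δ hδmem (γ⁻¹ • x)
  have e1 : s₁ + β * δ = t' := by rw [hs₁_def]; ring
  have e2 : γ • γ⁻¹ • x = x := by rw [smul_smul, mul_inv_cancel₀ hγ.ne', one_smul]
  rw [zoom_slice] at key
  simp only [e1, e2, norm_smul, Real.norm_eq_abs, abs_of_pos hα] at key
  -- `key : α * ‖u t' x‖ ≤ C_b * δ ^ (-1/2)`
  have hCα : Cb * δ ^ (-(1 / 2 : ℝ)) * L / ν = Cb * δ ^ (-(1 / 2 : ℝ)) / α := by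
    rw [hα_def]; field_simp
  rw [hCα, le_div_iff₀ hα, mul_comm]
  exact key

/-! ### The stub -/

/-- **stub 3a — `stub_zoomBound` (the quantitative `Ḣ¹`-subcritical bound).** There is a
UNIVERSAL constant `C` such that: if a classical solution of the unforced Navier–Stokes system on
`ℝ³ × [0, T)`, Leray–Hopf from a rapidly decaying datum and Tao-class on every `[0, T']`,
`T' < T`, has enstrophy `≤ L` on `[0, tc]` (`0 < tc < T`, `0 < L`), then `‖u(t, x)‖ ≤ C · L/ν`
for all `x` and all `t ∈ [ν³/L², tc]` — the enstrophy-normalised zoom (viscosity `1`, enstrophy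
`≤ 1`) is bounded by `C` after one unit of rescaled time. Proof: `core_bound` for `t < tc`
(note `δ ν³/L² ≤ ν³/L² ≤ t`); at `t = tc` the bound on `[δ ν³/L², tc)` passes to the limit
`τ → tc⁻` by continuity of `τ ↦ u(τ, x)` on `[0, T)`. -/
theorem stub_zoomBound :
    ∃ C : ℝ, ∀ (ν T : ℝ), 0 < ν → 0 < T →
      ∀ (u : ℝ → EuclideanSpace ℝ (Fin 3) → EuclideanSpace ℝ (Fin 3))
        (p : ℝ → EuclideanSpace ℝ (Fin 3) → ℝ),
        IsClassicalNSSolutionOn (Set.Ico 0 T) ν 0 u p → IsLerayHopfOn T ν 0 (u 0) u →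
        HasRapidSpatialDecay (u 0) →
        (∀ T' ∈ Set.Ioo 0 T, ∃ P : ℝ → EuclideanSpace ℝ (Fin 3) → ℝ,
          IsTaoSolutionOn T' ν (u 0) u P) →
        ∀ (tc L : ℝ), 0 < tc → tc < T → 0 < L →
          (∀ t ∈ Set.Icc 0 tc,
            ∫⁻ x, ENNReal.ofReal (frobeniusNormSq (fderiv ℝ (u t) x)) ≤ ENNReal.ofReal L) →
          ∀ t ∈ Set.Icc (ν ^ 3 / L ^ 2) tc, ∀ x, ‖u t x‖ ≤ C * L / ν := by
  obtain ⟨δ, C, _, hδ1, hcore⟩ := core_bound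
  refine ⟨C, ?_⟩
  intro ν T hν _hT u _p hcl hLH _hdec hrep tc L htc htcT hL hE t ht x
  have hβ : 0 < ν ^ 3 / L ^ 2 := by positivity
  have hδβ : δ * (ν ^ 3 / L ^ 2) < ν ^ 3 / L ^ 2 := mul_lt_of_lt_one_left hβ hδ1
  have h := hcore ν T hν u hLH hrep tc L htcT hL hE
  rcases lt_or_eq_of_le ht.2 with hlt | heq
  · exact h t (hδβ.le.trans ht.1) hlt x
  · -- `t = tc`: the bound before `tc` passes to the limit along `τ → tc⁻`
    have htT : t ∈ Ico 0 T := ⟨hβ.le.trans ht.1, heq ▸ htcT⟩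
    have hcont : ContinuousWithinAt (fun τ => u τ x) (Iio t) t := by
      have h1 : ContinuousOn (uncurry u) (Ico 0 T ×ˢ univ) := hcl.smooth_velocity.continuousOn
      have h2 : ContinuousOn (fun τ : ℝ => ((τ, x) : ℝ × EuclideanSpace ℝ (Fin 3))) (Ico 0 T) :=
        (continuous_id.prodMk continuous_const).continuousOn
      have h3 : ContinuousOn
          (uncurry u ∘ fun τ : ℝ => ((τ, x) : ℝ × EuclideanSpace ℝ (Fin 3))) (Ico 0 T) :=
        h1.comp h2 fun τ hτ => ⟨hτ, mem_univ _⟩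
      refine (h3 t htT).mono_of_mem_nhdsWithin
        (mem_of_superset (Ioo_mem_nhdsLT (heq ▸ htc)) ?_)
      exact fun τ hτ => ⟨hτ.1.le, hτ.2.trans_le (heq ▸ htcT.le)⟩
    have hlim : Tendsto (fun τ => ‖u τ x‖) (𝓝[<] t) (𝓝 ‖u t x‖) := hcont.norm
    refine le_of_tendsto hlim ?_
    filter_upwards [Ico_mem_nhdsLT (hδβ.trans_le ht.1)] with τ hτ
    exact h τ hτ.1 (heq ▸ hτ.2) x

end Summit.NavierStokesRegularity.NavierStokesRegularity.Theorems.RecordZoomAncient.Birth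

end
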